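import Literature.AlgebraicGeometry.GroupSchemes.BirationalGroupLawStrictification
import Mathlib.AlgebraicGeometry.Birational.RationalMap
import HarnessLib

/-!
# Transport of a birational group law along open immersions over the base
# (chart plumbing for Weil's gluing step: Artin, *Néron models*, §2, Lemma 2.4)

Topic `Literature/AlgebraicGeometry/GroupSchemes`, namespace `Literature.AlgebraicGeometry.GroupSchemes`.
KERNEL ONLY: theorems; no definition, no named fact, no instance, no `sorry`.  Cell `hodgecm-mathlib` (D-0151),
road W (Néron capital), piece (G2b) of the W1c design (`A-provers/A-p06/W1c-DESIGN.A-p06g5.md`): in Artin's gluing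
step `V′ = V ∪_{W_s} V_s` ([Artin1986NeronModels] §2, Lemma 2.4) the law on `V′` is assembled from CHARTS — opens of
`V′ ×_S V′` of the form `(f ⊗ g)(dom)` for open immersions `f, g ∈ {i₁, i₂} : V → V′` over `S`, with value `mul ≫ h`.
This file is the plumbing common to all charts, for `S`-morphisms `f g h : 𝒱 → 𝒲` with `f`, `g` open immersions
and a birational group law `L` on `𝒱` (tree `StrictBirationalGroupLaw`):

* `isOpenImmersion_tensorHom_left`, `tensorHom_left_fst_left` / `…snd…`, `fst_tensorHom_base` / `snd_…`,
  `range_tensorHom_left_base` — `f ⊗ g : 𝒱 ×_S 𝒱 → 𝒲 ×_S 𝒲` is an open immersion with the expected coordinates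
  and range `pr₁⁻¹ f(𝒱) ∩ pr₂⁻¹ g(𝒱)`;
* `IsFibrewiseDense.image_tensorHom` — `(f ⊗ g)(U)` is dense in every fibre of `𝒲 ×_S 𝒲 → S` when `U` is so in
  `𝒱 ×_S 𝒱 → S`, the fibres of `𝒲 ×_S 𝒲 → S` are preirreducible and `f(𝒱)`, `g(𝒱)` are fibrewise dense
  ([Artin1986NeronModels] Lemma 2.4 «`V` is dense in each fibre of `V′`»);
* `BirationalGroupLaw.isOpenImmersion_chart`, `computes_chart`, `eq_of_computes_chart` — the chart
  `dom —ι→ 𝒱 ×_S 𝒱 —f⊗g→ 𝒲 ×_S 𝒲` is an open immersion; its `T`-points computing `a′·b′ = c′` for the chart law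
  `(χ.opensRange, χ.isoOpensRange⁻¹ ≫ mul ≫ h)` (Mathlib `Scheme.Hom.opensRange` / `isoOpensRange`, the shape in
  which a chart enters a `Scheme.PartialMap`) are exactly the `T`-points of `dom`, read through `f`, `g`, `h`;
* `BirationalGroupLaw.assoc_chart` — for `f = g = h = i` the chart law is associative on `T`-points
  ([EdixhovenRomagny] Def. 3.4 (3) transported through the monomorphism `i`).

[Artin1986NeronModels] M. Artin, *Néron models*, in Cornell–Silverman, *Arithmetic Geometry* (1986), §2, Lemma 2.4,
p. 222 (held: `book:cornellnd-arithmetic-geometry` p0293); [EdixhovenRomagny] Def. 3.4, Prop. 3.2 (held).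
HC_CM is not proved here; nothing here changes the floor.

## References
* [Artin1986NeronModels] M. Artin, *Néron models*, in *Arithmetic Geometry* (Cornell, Silverman eds.), Springer 1986, §2.
* [EdixhovenRomagny] B. Edixhoven, M. Romagny, *Group schemes out of birational group laws, Néron models*, Panor. Synthèses 47 (2015), §3.
-/

noncomputable section

namespace Literature.AlgebraicGeometry.GroupSchemes

open CategoryTheory CategoryTheory.Limits _root_.AlgebraicGeometry MonoidalCategory CartesianMonoidalCategory
  TopologicalSpace
open scoped CategoryTheory.Obj

universe u

variable {S : Scheme.{u}} {𝒱 𝒲 : Over S}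

/-! ## §1. The product `f ⊗ g` of two open immersions over `S` -/

section TensorHom

variable (f g : 𝒱 ⟶ 𝒲)

/-- The product over `S` of two open immersions is an open immersion (the chart `V × V ⊆ V′ × V′` of Artin's gluing
step). [cite: Artin1986NeronModels, §2 Lemma 2.4 p. 222] -/
theorem isOpenImmersion_tensorHom_left [IsOpenImmersion f.left] [IsOpenImmersion g.left] :
    IsOpenImmersion (f ⊗ₘ g).left := by
  rw [Over.tensorHom_left]
  exact Scheme.pullback_map_isOpenImmersion _ _ _ _ _ _ _ _ _

/-- First coordinate of `f ⊗ g`. [cite: Artin1986NeronModels, §2 Lemma 2.4 p. 222] -/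
theorem tensorHom_left_fst_left : (f ⊗ₘ g).left ≫ (fst 𝒲 𝒲).left = (fst 𝒱 𝒱).left ≫ f.left :=
  congrArg CommaMorphism.left (tensorHom_fst f g)

/-- Second coordinate of `f ⊗ g`. [cite: Artin1986NeronModels, §2 Lemma 2.4 p. 222] -/
theorem tensorHom_left_snd_left : (f ⊗ₘ g).left ≫ (snd 𝒲 𝒲).left = (snd 𝒱 𝒱).left ≫ g.left :=
  congrArg CommaMorphism.left (tensorHom_snd f g)

/-- First coordinate of `f ⊗ g` on points. [cite: Artin1986NeronModels, §2 Lemma 2.4 p. 222] -/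
theorem fst_tensorHom_base (w : ↑(𝒱 ⊗ 𝒱).left) :
    (fst 𝒲 𝒲).left.base ((f ⊗ₘ g).left.base w) = f.left.base ((fst 𝒱 𝒱).left.base w) := by
  change ((f ⊗ₘ g).left ≫ (fst 𝒲 𝒲).left).base w = ((fst 𝒱 𝒱).left ≫ f.left).base w
  rw [tensorHom_left_fst_left]

/-- Second coordinate of `f ⊗ g` on points. [cite: Artin1986NeronModels, §2 Lemma 2.4 p. 222] -/
theorem snd_tensorHom_base (w : ↑(𝒱 ⊗ 𝒱).left) :
    (snd 𝒲 𝒲).left.base ((f ⊗ₘ g).left.base w) = g.left.base ((snd 𝒱 𝒱).left.base w) := by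
  change ((f ⊗ₘ g).left ≫ (snd 𝒲 𝒲).left).base w = ((snd 𝒱 𝒱).left ≫ g.left).base w
  rw [tensorHom_left_snd_left]

/-- The range of `f ⊗ g` is the set of points whose two coordinates lie in the ranges of `f` and `g` (`V_s × V`,
`V × V_s`, … inside `V′ × V′`). [cite: Artin1986NeronModels, §2 Lemma 2.4 p. 222] -/
theorem range_tensorHom_left_base :
    Set.range (f ⊗ₘ g).left.base =
      (fst 𝒲 𝒲).left.base ⁻¹' Set.range f.left.base ∩ (snd 𝒲 𝒲).left.base ⁻¹' Set.range g.left.base := by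
  rw [Over.tensorHom_left]
  exact Scheme.Pullback.range_map _ _ _ _ _ _ _ _ _

end TensorHom

/-! ## §1b. Fibrewise density of images under `f ⊗ g` -/

section Density

variable (f g : 𝒱 ⟶ 𝒲) [IsOpenImmersion f.left] [IsOpenImmersion g.left]

/-- Points of `𝒳 ×_S 𝒳` lie over `S` through the first projection. [folklore] -/
private theorem hom_base_fst' {𝒳 : Over S} (w : ↑(𝒳 ⊗ 𝒳).left) :
    𝒳.hom.base ((fst 𝒳 𝒳).left.base w) = (𝒳 ⊗ 𝒳).hom.base w := by
  change ((fst 𝒳 𝒳).left ≫ 𝒳.hom).base w = _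
  rw [Over.w (fst 𝒳 𝒳)]

/-- **The image under `f ⊗ g` of an open of `𝒱 ×_S 𝒱` dense in every fibre over `S` is dense in every fibre of
`𝒲 ×_S 𝒲 → S`**, provided the fibres of `𝒲 ×_S 𝒲 → S` are preirreducible and `f(𝒱)`, `g(𝒱)` meet every
non-empty fibre of `𝒲 → S`. [cite: EdixhovenRomagny, Prop. 3.2 (2)] [cite: Artin1986NeronModels, Lemma 2.4 p. 222] -/
theorem IsFibrewiseDense.image_tensorHom {U : Set ↑(𝒱 ⊗ 𝒱).left} (hUo : IsOpen U)
    (hU : IsFibrewiseDense (𝒱 ⊗ 𝒱).hom U)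
    (hirr : ∀ t : S, IsPreirreducible ((𝒲 ⊗ 𝒲).hom.base ⁻¹' {t}))
    (hf : IsFibrewiseDense 𝒲.hom (Set.range f.left.base)) (hg : IsFibrewiseDense 𝒲.hom (Set.range g.left.base)) :
    IsFibrewiseDense (𝒲 ⊗ 𝒲).hom ((f ⊗ₘ g).left.base '' U) := by
  haveI := isOpenImmersion_tensorHom_left f g
  refine IsFibrewiseDense.of_isOpen_of_forall_nonempty ((f ⊗ₘ g).left.isOpenEmbedding.isOpenMap _ hUo) hirr
    fun t ⟨w, hw⟩ => ?_
  -- a point of `𝒲` over `t`, hence points `v`, `v'` of `𝒱` over `t` with `f v`, `g v'` defined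
  have hw₁ : 𝒲.hom.base ((fst 𝒲 𝒲).left.base w) = t := by rw [hom_base_fst']; exact hw
  obtain ⟨_, ⟨v, rfl⟩, hv⟩ := hf.nonempty_inter_fibre ⟨_, hw₁⟩
  obtain ⟨_, ⟨v', rfl⟩, hv'⟩ := hg.nonempty_inter_fibre ⟨_, hw₁⟩
  have hvt : 𝒱.hom.base v = t := by
    have : (f.left ≫ 𝒲.hom).base v = t := hv
    rwa [Over.w f] at this
  have hv't : 𝒱.hom.base v' = t := by
    have : (g.left ≫ 𝒲.hom).base v' = t := hv'
    rwa [Over.w g] at this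
  obtain ⟨z, hz₁, -⟩ := Scheme.Pullback.exists_preimage_pullback (f := 𝒱.hom) (g := 𝒱.hom) v v'
    (hvt.trans hv't.symm)
  have hzt : (𝒱 ⊗ 𝒱).hom.base z = t := by
    rw [← hom_base_fst']; change 𝒱.hom.base ((pullback.fst 𝒱.hom 𝒱.hom).base z) = t; rw [hz₁]; exact hvt
  obtain ⟨u, huU, hut⟩ := hU.nonempty_inter_fibre ⟨z, hzt⟩
  refine ⟨(f ⊗ₘ g).left.base u, ⟨u, huU, rfl⟩, ?_⟩
  change ((f ⊗ₘ g).left ≫ (𝒲 ⊗ 𝒲).hom).base u = t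
  rw [Over.w (f ⊗ₘ g)]
  exact hut

end Density

/-! ## §2. The chart of `L` through `(f ⊗ g, h)`: `dom —(f⊗g)→ 𝒲 ×_S 𝒲`, value `mul ≫ h` -/

section Chart

namespace BirationalGroupLaw

variable (L : BirationalGroupLaw 𝒱) (f g h : 𝒱 ⟶ 𝒲) [IsOpenImmersion f.left] [IsOpenImmersion g.left]

/-- The chart embedding `dom ↪ 𝒱 ×_S 𝒱 —(f ⊗ g)→ 𝒲 ×_S 𝒲` is an open immersion.
[cite: Artin1986NeronModels, §2 Lemma 2.4 p. 222] -/
theorem isOpenImmersion_chart : IsOpenImmersion (L.dom.ι ≫ (f ⊗ₘ g).left) :=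
  haveI := isOpenImmersion_tensorHom_left f g
  inferInstance

/-- A `T`-point of `dom` computing `ab = c` gives, in the chart, a `T`-point computing
`f(a)·g(b) = h(c)`. [cite: Artin1986NeronModels, §2 Lemma 2.4 p. 222] [cite: EdixhovenRomagny, Def. 3.4 (3)] -/
theorem computes_chart {T : Scheme.{u}} {a b c : T ⟶ 𝒱.left} {q : T ⟶ (L.dom : Scheme.{u})}
    (hq : LawData.Computes 𝒱 L.dom L.mul q a b c) :
    haveI := isOpenImmersion_chart L f g
    LawData.Computes 𝒲 (L.dom.ι ≫ (f ⊗ₘ g).left).opensRange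
      ((L.dom.ι ≫ (f ⊗ₘ g).left).isoOpensRange.inv ≫ L.mul ≫ h.left)
      (q ≫ (L.dom.ι ≫ (f ⊗ₘ g).left).isoOpensRange.hom) (a ≫ f.left) (b ≫ g.left) (c ≫ h.left) := by
  haveI := isOpenImmersion_chart L f g
  obtain ⟨ha, hb, hc⟩ := hq
  refine ⟨?_, ?_, ?_⟩
  · rw [Category.assoc, Scheme.Hom.isoOpensRange_hom_ι_assoc, Category.assoc, tensorHom_left_fst_left, ← ha]
    simp only [Category.assoc]
  · rw [Category.assoc, Scheme.Hom.isoOpensRange_hom_ι_assoc, Category.assoc, tensorHom_left_snd_left, ← hb]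
    simp only [Category.assoc]
  · rw [Category.assoc, Iso.hom_inv_id_assoc, ← Category.assoc, hc]

/-- Conversely, a `T`-point of the chart computing `a′·b′ = c′` comes from a `T`-point `q` of `dom`, with
`a′ = f(π₁ q)`, `b′ = g(π₂ q)`, `c′ = h(mul q)`. [cite: Artin1986NeronModels, §2 Lemma 2.4 p. 222]
[cite: EdixhovenRomagny, Def. 3.4 (3)] -/
theorem eq_of_computes_chart {T : Scheme.{u}} {a' b' c' : T ⟶ 𝒲.left}
    {q' : T ⟶ (haveI := isOpenImmersion_chart L f g; ((L.dom.ι ≫ (f ⊗ₘ g).left).opensRange : Scheme.{u}))}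
    (hq' : haveI := isOpenImmersion_chart L f g
      LawData.Computes 𝒲 (L.dom.ι ≫ (f ⊗ₘ g).left).opensRange
        ((L.dom.ι ≫ (f ⊗ₘ g).left).isoOpensRange.inv ≫ L.mul ≫ h.left) q' a' b' c') :
    haveI := isOpenImmersion_chart L f g
    a' = (q' ≫ (L.dom.ι ≫ (f ⊗ₘ g).left).isoOpensRange.inv ≫ L.dom.ι ≫ (fst 𝒱 𝒱).left) ≫ f.left ∧
    b' = (q' ≫ (L.dom.ι ≫ (f ⊗ₘ g).left).isoOpensRange.inv ≫ L.dom.ι ≫ (snd 𝒱 𝒱).left) ≫ g.left ∧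
    c' = (q' ≫ (L.dom.ι ≫ (f ⊗ₘ g).left).isoOpensRange.inv ≫ L.mul) ≫ h.left := by
  haveI := isOpenImmersion_chart L f g
  obtain ⟨ha, hb, hc⟩ := hq'
  refine ⟨?_, ?_, ?_⟩
  · rw [← ha]
    simp only [Category.assoc, ← tensorHom_left_fst_left f g]
    rw [← Category.assoc L.dom.ι, Scheme.Hom.isoOpensRange_inv_comp_assoc]
  · rw [← hb]
    simp only [Category.assoc, ← tensorHom_left_snd_left f g]
    rw [← Category.assoc L.dom.ι, Scheme.Hom.isoOpensRange_inv_comp_assoc]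
  · rw [← hc]
    simp only [Category.assoc]

end BirationalGroupLaw

end Chart

/-! ## §3. Associativity of the transported law (one open immersion `i` on all three coordinates) -/

section Assoc

namespace BirationalGroupLaw

variable (L : BirationalGroupLaw 𝒱) (i : 𝒱 ⟶ 𝒲) [IsOpenImmersion i.left]

/-- **The law transported along an open immersion `i : 𝒱 → 𝒲` over `S` is associative on `T`-points**: the
`T`-points of the chart `dom ≅ (i ⊗ i)(dom)` are those of `dom`, their coordinates are read through the
monomorphism `i`, and `L.assoc` applies. [cite: EdixhovenRomagny, Def. 3.4 (3)] -/
theorem assoc_chart {T : Scheme.{u}} {a b c ab bc abc abc' : T ⟶ 𝒲.left}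
    {q₁ q₂ q₃ q₄ : T ⟶ (haveI := isOpenImmersion_chart L i i; ((L.dom.ι ≫ (i ⊗ₘ i).left).opensRange : Scheme.{u}))}
    (h₁ : haveI := isOpenImmersion_chart L i i
      LawData.Computes 𝒲 (L.dom.ι ≫ (i ⊗ₘ i).left).opensRange
        ((L.dom.ι ≫ (i ⊗ₘ i).left).isoOpensRange.inv ≫ L.mul ≫ i.left) q₁ a b ab)
    (h₂ : haveI := isOpenImmersion_chart L i i
      LawData.Computes 𝒲 (L.dom.ι ≫ (i ⊗ₘ i).left).opensRange
        ((L.dom.ι ≫ (i ⊗ₘ i).left).isoOpensRange.inv ≫ L.mul ≫ i.left) q₂ b c bc)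
    (h₃ : haveI := isOpenImmersion_chart L i i
      LawData.Computes 𝒲 (L.dom.ι ≫ (i ⊗ₘ i).left).opensRange
        ((L.dom.ι ≫ (i ⊗ₘ i).left).isoOpensRange.inv ≫ L.mul ≫ i.left) q₃ ab c abc)
    (h₄ : haveI := isOpenImmersion_chart L i i
      LawData.Computes 𝒲 (L.dom.ι ≫ (i ⊗ₘ i).left).opensRange
        ((L.dom.ι ≫ (i ⊗ₘ i).left).isoOpensRange.inv ≫ L.mul ≫ i.left) q₄ a bc abc') :
    abc = abc' := by
  haveI := isOpenImmersion_chart L i i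
  obtain ⟨h₁a, h₁b, h₁c⟩ := eq_of_computes_chart L i i i h₁
  obtain ⟨h₂a, h₂b, h₂c⟩ := eq_of_computes_chart L i i i h₂
  obtain ⟨h₃a, h₃b, h₃c⟩ := eq_of_computes_chart L i i i h₃
  obtain ⟨h₄a, h₄b, h₄c⟩ := eq_of_computes_chart L i i i h₄
  set e := (L.dom.ι ≫ (i ⊗ₘ i).left).isoOpensRange with he
  -- identifications of coordinates through the monomorphism `i.left`
  have eb : q₁ ≫ e.inv ≫ L.dom.ι ≫ (snd 𝒱 𝒱).left = q₂ ≫ e.inv ≫ L.dom.ι ≫ (fst 𝒱 𝒱).left := by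
    rw [← cancel_mono i.left]; simpa only [Category.assoc] using h₁b.symm.trans h₂a
  have eab : q₁ ≫ e.inv ≫ L.mul = q₃ ≫ e.inv ≫ L.dom.ι ≫ (fst 𝒱 𝒱).left := by
    rw [← cancel_mono i.left]; simpa only [Category.assoc] using h₁c.symm.trans h₃a
  have ec : q₂ ≫ e.inv ≫ L.dom.ι ≫ (snd 𝒱 𝒱).left = q₃ ≫ e.inv ≫ L.dom.ι ≫ (snd 𝒱 𝒱).left := by
    rw [← cancel_mono i.left]; simpa only [Category.assoc] using h₂b.symm.trans h₃b
  have ea : q₁ ≫ e.inv ≫ L.dom.ι ≫ (fst 𝒱 𝒱).left = q₄ ≫ e.inv ≫ L.dom.ι ≫ (fst 𝒱 𝒱).left := by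
    rw [← cancel_mono i.left]; simpa only [Category.assoc] using h₁a.symm.trans h₄a
  have ebc : q₂ ≫ e.inv ≫ L.mul = q₄ ≫ e.inv ≫ L.dom.ι ≫ (snd 𝒱 𝒱).left := by
    rw [← cancel_mono i.left]; simpa only [Category.assoc] using h₂c.symm.trans h₄b
  have key : (q₃ ≫ e.inv) ≫ L.mul = (q₄ ≫ e.inv) ≫ L.mul :=
    L.assoc (q₁ := q₁ ≫ e.inv) (q₂ := q₂ ≫ e.inv) (q₃ := q₃ ≫ e.inv) (q₄ := q₄ ≫ e.inv)
      (a := q₁ ≫ e.inv ≫ L.dom.ι ≫ (fst 𝒱 𝒱).left) (b := q₁ ≫ e.inv ≫ L.dom.ι ≫ (snd 𝒱 𝒱).left)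
      (c := q₂ ≫ e.inv ≫ L.dom.ι ≫ (snd 𝒱 𝒱).left) (ab := q₁ ≫ e.inv ≫ L.mul) (bc := q₂ ≫ e.inv ≫ L.mul)
      ⟨by simp only [Category.assoc], by simp only [Category.assoc], by simp only [Category.assoc]⟩
      ⟨by simpa only [Category.assoc] using eb.symm, by simp only [Category.assoc], by simp only [Category.assoc]⟩
      ⟨by simpa only [Category.assoc] using eab.symm, by simpa only [Category.assoc] using ec.symm,
        by simp only [Category.assoc]⟩
      ⟨by simpa only [Category.assoc] using ea.symm, by simpa only [Category.assoc] using ebc.symm,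
        by simp only [Category.assoc]⟩
  rw [h₃c, h₄c]
  simpa only [Category.assoc] using congrArg (· ≫ i.left) key

end BirationalGroupLaw

end Assoc


end Literature.AlgebraicGeometry.GroupSchemes

end
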